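import Summits.Ventures.PercRepro.GenQRankFiveRowsFree
import Summits.Ventures.PercRepro.GenQFlatGood

/-!
# PercRepro — THE ROW (R6a) WITHOUT `Core` AT `q = 8`: `20·#{|G ∖ S| < 6} + Σ_s c₆(s)·NR 5 s ≤ 20·DF₆` (night-4, gen 21)

The twin of `DFq_ge_c6` (`GenQRankFiveRows`) for the two-level certificate modules of the `(10, 8)` type layer, whose
hypotheses are the explicit flat bounds (lines `≤ 3`, planes `≤ 6`, solids `≤ 10`, rank-`5` flats `≤ 21`, rank-`6`
flats `≤ 43`, rank-`7` flats `≤ 87`) rather than `Core M p`: `sizeChain_eight_of_flats` gives `SizeChain M 8 fCore`,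
so on a rank-`5` flat with `≥ 17` points of `G` every rank-`5` `6`-subset is good (`goodSets_eq_rkSets_of_large`) and
the rank-step bound `twenty_mul_choose_six_le_of_flats` counts them; `c6Twenty s = rho6Twenty s` for `s ≥ 17`, `0`
below; the row is stated `×20` so the LP builder's rational `ρ₆ = c6Twenty / 20` is exact in `ℚ`.
Imports `GenQRankFiveRowsFree` (`rho6Twenty`, `twenty_mul_choose_six_le_of_flats`) and `GenQFlatGood` (`goodSets`,
`goodSets_eq_rkSets_of_large`, `DFq_ge_flat_good_rows`' ingredients).
-/
namespace PercRepro.Night4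

open Finset ThmH SixFour GenQ PerFlat Star NightThree

variable {α : Type} [DecidableEq α] {M : Matroid α} [M.Finite]

/-- The core chain up to rank `7` from the explicit flat bounds: `SizeChain M 8 fCore`. -/
theorem sizeChain_eight_of_flats (hs : Simple M) (hline : ∀ L ∈ flatsQ M 2, L.card ≤ 3)
    (hplane : ∀ P ∈ flatsQ M 3, P.card ≤ 6) (hsolid : ∀ F ∈ flatsQ M 4, F.card ≤ 10)
    (hflat5 : ∀ F ∈ flatsQ M 5, F.card ≤ 21) (hflat6 : ∀ F ∈ flatsQ M 6, F.card ≤ 43)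
    (hflat7 : ∀ F ∈ flatsQ M 7, F.card ≤ 87) : SizeChain M 8 fCore := by
  refine sizeChain_of_flats fCore_mono (fun r hr F hF => ?_)
  rcases (show r = 0 ∨ r = 1 ∨ r = 2 ∨ r = 3 ∨ r = 4 ∨ r = 5 ∨ r = 6 ∨ r = 7 by omega) with
    h | h | h | h | h | h | h | h <;> subst h
  · exact (card_le_one_of_flatsQ_le_one hs (by norm_num) hF).trans (by decide)
  · exact (card_le_one_of_flatsQ_le_one hs (by norm_num) hF).trans (by decide)
  · exact hline F hF
  · exact hplane F hF
  · exact hsolid F hF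
  · exact hflat5 F hF
  · exact hflat6 F hF
  · exact hflat7 F hF

/-- **`20·C(s, 6) ≤ 20·#goodSets + 50·C(s, 4) + 2·C(s, 3)`** on a rank-`5` flat `F` with `s = |F ∩ G| ≥ 17` points of
the rank-`8` set `G` (the `Core`-free form of `twenty_mul_choose_six_le_good` at `q = 8`). -/
theorem twenty_mul_choose_six_le_good_of_flats (hs : Simple M) (hline : ∀ L ∈ flatsQ M 2, L.card ≤ 3)
    (hplane : ∀ P ∈ flatsQ M 3, P.card ≤ 6) (hsolid : ∀ F ∈ flatsQ M 4, F.card ≤ 10)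
    (hflat5 : ∀ F ∈ flatsQ M 5, F.card ≤ 21) (hflat6 : ∀ F ∈ flatsQ M 6, F.card ≤ 43)
    (hflat7 : ∀ F ∈ flatsQ M 7, F.card ≤ 87) {G F : Finset α} (hG : G ⊆ gr M)
    (hrG : M.eRk (G : Set α) = ((8 : ℕ) : ℕ∞)) (hF : F ∈ flatsQ M 5) (h17 : 17 ≤ (F ∩ G).card) :
    20 * (F ∩ G).card.choose 6 ≤ 20 * (goodSets M G F 8 6 5).card + 50 * (F ∩ G).card.choose 4 +
      2 * (F ∩ G).card.choose 3 := by
  have hbig : 6 + fCore (5 - 1) < (F ∩ G).card := by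
    show 6 + 10 < (F ∩ G).card
    omega
  rw [goodSets_eq_rkSets_of_large (sizeChain_eight_of_flats hs hline hplane hsolid hflat5 hflat6 hflat7) hG hrG hF
    (by norm_num) (by norm_num) hbig]
  exact twenty_mul_choose_six_le_of_flats hs hline hplane hsolid hflat5 hflat6 hF Finset.inter_subset_left

/-- `c₆(s) = ρ₆(s)` (`= 20C(s,6) − 50C(s,4) − 2C(s,3)`) for `s ≥ 17`, `0` below. -/
def c6Twenty (s : ℕ) : ℕ := if 17 ≤ s then rho6Twenty s else 0

/-- **`c₆(|F ∩ G|) ≤ 20·#goodSets`** for a rank-`5` flat `F` of the rank-`8` set `G`. -/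
theorem c6Twenty_le_good (hs : Simple M) (hline : ∀ L ∈ flatsQ M 2, L.card ≤ 3)
    (hplane : ∀ P ∈ flatsQ M 3, P.card ≤ 6) (hsolid : ∀ F ∈ flatsQ M 4, F.card ≤ 10)
    (hflat5 : ∀ F ∈ flatsQ M 5, F.card ≤ 21) (hflat6 : ∀ F ∈ flatsQ M 6, F.card ≤ 43)
    (hflat7 : ∀ F ∈ flatsQ M 7, F.card ≤ 87) {G : Finset α} (hG : G ⊆ gr M)
    (hrG : M.eRk (G : Set α) = ((8 : ℕ) : ℕ∞)) {F : Finset α} (hF : F ∈ flatsQ M 5) :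
    c6Twenty (F ∩ G).card ≤ 20 * (goodSets M G F 8 6 (6 - 1)).card := by
  show c6Twenty (F ∩ G).card ≤ 20 * (goodSets M G F 8 6 5).card
  unfold c6Twenty
  split_ifs with h17
  · have h := twenty_mul_choose_six_le_good_of_flats hs hline hplane hsolid hflat5 hflat6 hflat7 hG hrG hF h17
    unfold rho6Twenty
    omega
  · exact Nat.zero_le _

/-- **THE ROW (R6a) AT `q = 8`, twenty-fold**: `20·#{|G ∖ S| < 6} + Σ_s c₆(s)·NR 5 s ≤ 20·DF₆` on a rank-`8` subset
`G` of a simple matroid with the core's flat bounds. -/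
theorem DFq_ge_c6Twenty (hs : Simple M) (hline : ∀ L ∈ flatsQ M 2, L.card ≤ 3)
    (hplane : ∀ P ∈ flatsQ M 3, P.card ≤ 6) (hsolid : ∀ F ∈ flatsQ M 4, F.card ≤ 10)
    (hflat5 : ∀ F ∈ flatsQ M 5, F.card ≤ 21) (hflat6 : ∀ F ∈ flatsQ M 6, F.card ≤ 43)
    (hflat7 : ∀ F ∈ flatsQ M 7, F.card ≤ 87) {G : Finset α} (hG : G ⊆ gr M)
    (hrG : M.eRk (G : Set α) = ((8 : ℕ) : ℕ∞)) :
    20 * ((Rq M G 8).filter (fun S : Finset α => (G \ S).card < 6)).card +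
      ∑ s ∈ Finset.range (G.card + 1), c6Twenty s * NR M G 5 s ≤ 20 * DFq M G 8 6 := by
  have h1 := DFq_ge_levels_add_rank_le (M := M) G 8 6
  have h2 := sum_goodSets_le (M := M) G 8 6 5
  have h3 : ∑ s ∈ Finset.range (G.card + 1), c6Twenty s * NR M G 5 s ≤
      20 * ∑ F ∈ flatsQ M 5, (goodSets M G F 8 6 5).card := by
    rw [Finset.mul_sum, ← sum_flats_fn_eq]
    exact Finset.sum_le_sum (fun F hF => c6Twenty_le_good hs hline hplane hsolid hflat5 hflat6 hflat7 hG hrG hF)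
  have ht' : ((5 + 1 : ℕ) : ℕ∞) = ((6 : ℕ) : ℕ∞) := by norm_num
  rw [ht'] at h2
  omega

/-- The values of `c₆` on the core's range: `0` up to `s = 16`, then `127160, 216648, 346902, 530670, 783370`. -/
theorem c6Twenty_values : c6Twenty 16 = 0 ∧ c6Twenty 17 = 127160 ∧ c6Twenty 18 = 216648 ∧ c6Twenty 19 = 346902 ∧
    c6Twenty 20 = 530670 ∧ c6Twenty 21 = 783370 := by
  refine ⟨?_, ?_, ?_, ?_, ?_, ?_⟩ <;> decide

end PercRepro.Night4
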